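import Literature.Barriers.AtomisticToContinuum.HalfFillingGaussianDomination
import HarnessLib

/-!
# Dyson–Lieb–Simon: Gaussian domination at positive temperature for the rotated Heisenberg
# antiferromagnet

Sibling proof file of `HeisenbergOrder.lean` (item `provefact … dyson_lieb_simon`, step (GD) of
the plan recorded there). No named fact is introduced; everything here is proved.

After the rotation by `π` about the `2`-axis on the odd sublattice of the even torus
([DLS1978] proof of Thm. 6.1: "rotations by `π` about the y axis for `|α|` odd"), the
antiferromagnetic Heisenberg Hamiltonian `J Σ_{⟨xy⟩} 𝐒_x·𝐒_y` (`J > 0`) becomes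
`H♯ = J Σ_{⟨xy⟩} (-S¹_xS¹_y + S²_xS²_y - S³_xS³_y)` — "ferromagnetic in the 1 and 3 variables, which
have real representatives, and antiferromagnetic in the 2 variable, which has an imaginary
representative" [DLS1978, p. 366]. In the real matrices `T¹ = S¹`, `T² = iS²`, `T³ = S³` this is
`-J Σ (T¹T¹ + T²T² + T³T³)`, i.e. `J` times the rotated XY form `H♭` of `XYOrderReflection.lean`
minus `J Σ S³S³`. This file proves, for the field Hamiltonian with the field on the first
component (completed square on that component only, as in `xyFieldHamiltonian`),

`X(g) = H♭(g) - Σ_{⟨xy⟩} S³_xS³_y`,  `H♭(g) = xyRealFieldHamiltonian L n g`,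

**Gaussian domination at every inverse temperature** `β > 0` on the even torus of side `L ≥ 4`:
`Z_β(X(g)) ≤ Z_β(X(0))` (`dls_partitionFn_field_le`), i.e. [DLS1978] Thm. 4.2 / (48) for the
Hamiltonian of [DLS1978] Thm. 6.1 (with `β ↦ βJ` this is Gaussian domination for `H♯(g)`).

## The proof ([DLS1978] Lemma 4.1, Thm. 4.2, Lemma 6.1, Thm. 6.1)

* Along every pair of reflection planes the operator `X(g)` has the Kronecker form
  `(A - Z) ⊗ 1 + 1 ⊗ (B - Z) - (Σᵢ Mᵢ ⊗ Nᵢ + Σ_x T³_x ⊗ T³_x)` with the real matrices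
  `A, B, Mᵢ, Nᵢ` of the XY Kronecker form (`xyRealFieldHamiltonian_eq_submatrix`,
  `XYOrderGDProofs.lean`) and the real `Z = Σ_{left bonds} S³S³`, `T³_x = S³_x` for the left
  endpoints `x` of the crossing bonds (`torusZZBondSum_eq_submatrix`, `dlsField_eq_submatrix`);
* the Dyson–Lieb–Simon trace inequality `Matrix.trace_exp_kroneckerSum_le`
  (`KroneckerTraceSchwarz.lean`, [DLS1978] Lemma 4.1) gives `Z(g)² ≤ Z(g^L) Z(g^R)`
  (`partitionFn_dlsField_sq_le`);
* the descent of [DLS1978] proof of Thm. 4.2 (as formalised for the hard-core gas in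
  `HalfFillingGaussianDomination.lean`): maximise `Z` over the finitely many fields with values in
  the range of `g`, minimise the number of bonds with `g_x ≠ g_y`, and contradict a bad bond with
  the planes through it (`badBondCount_reflect`).

## References

* [DLS1978] F. J. Dyson, E. H. Lieb, B. Simon, *Phase transitions in quantum spin systems with
  isotropic and nonisotropic interactions*, J. Stat. Phys. 18 (1978) 335–383, Lemma 4.1,
  Thm. 4.2 (eq. (48)), Lemma 6.1, Thm. 6.1 (read in: E. H. Lieb, *Statistical Mechanics
  (Selecta)*, Springer 2004, paper IV.3, pp. 353–356, 365–366).
* [KLS1988JSP] T. Kennedy, E. H. Lieb, B. S. Shastry, J. Stat. Phys. 53 (1988) 1019–1030,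
  eqs. (15)–(21) (the Kronecker form, ground-state version).
-/

noncomputable section

open Matrix Finset NormedSpace
open scoped ComplexOrder Kronecker
open Literature.MathematicalPhysics.QuantumLattice Literature.Probability.LatticeModels

namespace Literature.MathematicalPhysics.QuantumLattice

variable {d : ℕ}

/-! ### The `S³S³` bond sum and the rotated field Hamiltonian -/

section Defs

variable {Λ : Type*} [Fintype Λ] [DecidableEq Λ]

/-- The `3–3` bond term is symmetric (packaging for `Sym2.lift`). [folklore] -/
theorem spinBond_two_symm (n : ℕ) (x y : Λ) : spinBond n 2 x y = spinBond n 2 y x :=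
  (spinBond_comm n 2 x y).symm

end Defs

/-- The `S³S³` bond sum `Σ_{⟨xy⟩} ½(S³_xS³_y + S³_yS³_x)` over the edges of the torus graph.
[cite: DLS1978, Thm. 6.1 (proof)] -/
def torusZZBondSum (L : ℕ) [NeZero L] (n : ℕ) : Op (TorusSite d L) (n + 1) :=
  ∑ e ∈ (torusGraph d L).edgeFinset, Sym2.lift ⟨fun x y => spinBond n 2 x y, spinBond_two_symm n⟩ e

/-- **The rotated antiferromagnetic field Hamiltonian (unit coupling)**
`X(g) = H♭(g) - Σ_{⟨xy⟩} S³_xS³_y = Σ_{⟨xy⟩} [-S¹S¹ + S²S² - S³S³ - (g_x - g_y)(S¹_x - S¹_y) + ½(g_x - g_y)²]`: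
the Heisenberg antiferromagnet after the sublattice rotation by `π` about the `2`-axis, with a
real field `g` on the first component completed to a square ([DLS1978] (41b), Thm. 6.1).
[cite: DLS1978, Thm. 6.1] -/
def dlsField (L : ℕ) [NeZero L] (n : ℕ) (g : TorusSite d L → ℝ) : Op (TorusSite d L) (n + 1) :=
  xyRealFieldHamiltonian L n g - torusZZBondSum L n

/-! ### Hermiticity and reality -/

section Hermitian

variable (L : ℕ) [NeZero L] (n : ℕ)

/-- `Σ S³S³` is Hermitian. [folklore] -/
theorem torusZZBondSum_isHermitian : (torusZZBondSum (d := d) L n).IsHermitian := by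
  unfold torusZZBondSum
  exact isHermitian_sum_lift _ _ fun x y => spinBond_isHermitian n 2 x y

/-- `X(g)` is Hermitian. [folklore] -/
theorem dlsField_isHermitian (g : TorusSite d L → ℝ) : (dlsField L n g).IsHermitian :=
  (xyRealFieldHamiltonian_isHermitian L n g).sub (torusZZBondSum_isHermitian L n)

variable {Λ : Type*} [Fintype Λ] [DecidableEq Λ]

/-- `½(S³_xS³_y + S³_yS³_x)` is a real matrix. [folklore] -/
theorem spinBond_two_transpose_eq (x y : Λ) :
    (spinBond n 2 x y : Op Λ (n + 1))ᵀ = (spinBond n 2 x y)ᴴ := by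
  unfold spinBond
  have hx := siteSpin_two_transpose_eq (Λ := Λ) n x
  have hy := siteSpin_two_transpose_eq (Λ := Λ) n y
  rw [show (1 / 2 : ℂ) = ((1 / 2 : ℝ) : ℂ) by push_cast; ring]
  exact transpose_eq_conjTranspose_ofReal_smul (transpose_eq_conjTranspose_add
    (transpose_eq_conjTranspose_mul hx hy) (transpose_eq_conjTranspose_mul hy hx)) _

end Hermitian

/-! ### The Kronecker form of the `S³S³` bond sum along a pair of planes -/

section KroneckerForm

variable (L : ℕ) [NeZero L] (j : Fin d) (a : ZMod L) (hL : Even L) (n : ℕ)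

/-- The `S³S³` bond sum of the left half, `Z = Σ_{left bonds} ½(S³S³ + S³S³)`, as an operator on
the state space of the left half. [cite: DLS1978, Thm. 6.1 (proof)] -/
def torusZZLeft : Op (torusLeftHalf L j a) (n + 1) :=
  ∑ e ∈ torusLeftEdges L j a,
    Sym2.lift ⟨fun x y => spinBond n 2 (torusToLeft L j a hL x) (torusToLeft L j a hL y),
      fun _ _ => spinBond_two_symm n _ _⟩ e

/-- The crossing operators `T³_x = S³_x` (left endpoints of crossing bonds), on the left half.
[cite: DLS1978, Thm. 6.1 (proof)] -/
def torusZZCrossOp (x : torusCrossSites L j a) : Op (torusLeftHalf L j a) (n + 1) :=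
  siteSpin n (torusToLeft L j a hL x) 2

variable {L j a hL n}

/-- Left `S³S³` bonds are `τ ⊗ 1`. [folklore] -/
theorem spinBond_two_eq_torusLeftEmbed {x y : TorusSite d L}
    (hx : x ∈ torusLeftHalf L j a) (hy : y ∈ torusLeftHalf L j a) :
    spinBond n 2 x y = torusLeftEmbed L j a hL
      (spinBond n 2 (torusToLeft L j a hL x) (torusToLeft L j a hL y)) := by
  simp only [spinBond, map_smul, map_add, map_mul, ← siteSpin_eq_torusLeftEmbed n hx,
    ← siteSpin_eq_torusLeftEmbed n hy]

/-- Right `S³S³` bonds are `1 ⊗ τ`. [folklore] -/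
theorem spinBond_two_eq_torusRightEmbed {z w : TorusSite d L}
    (hz : z ∉ torusLeftHalf L j a) (hw : w ∉ torusLeftHalf L j a) :
    spinBond n 2 z w = torusRightEmbed L j a hL
      (spinBond n 2 (torusToLeft L j a hL z) (torusToLeft L j a hL w)) := by
  simp only [spinBond, map_smul, map_add, map_mul, ← siteSpin_eq_torusRightEmbed n hz,
    ← siteSpin_eq_torusRightEmbed n hw]

/-- Crossing `S³S³` bonds are `T³ ⊗ T³`: for a left endpoint `x` of a crossing bond,
`½(S³_xS³_{θx} + S³_{θx}S³_x) = (S³ ⊗ 1)(1 ⊗ S³)`. [cite: DLS1978, Lemma 6.1] -/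
theorem spinBond_two_cross (x : torusCrossSites L j a) :
    spinBond n 2 (x : TorusSite d L) (Torus.reflectBetweenSites j a x) =
      torusLeftEmbed L j a hL (torusZZCrossOp L j a hL n x) *
        torusRightEmbed L j a hL (torusZZCrossOp L j a hL n x) := by
  have hx : (x : TorusSite d L) ∈ torusLeftHalf L j a := (mem_torusCrossSites.1 x.2).1
  have hθ : Torus.reflectBetweenSites j a x ∉ torusLeftHalf L j a := fun h =>
    (reflectBetweenSites_mem_torusLeftHalf_iff L j a hL (x : TorusSite d L)).1 h hx
  have e1 : (siteSpin n (x : TorusSite d L) 2 : Op (TorusSite d L) (n + 1)) =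
      torusLeftEmbed L j a hL (siteSpin n (torusToLeft L j a hL x) 2) :=
    siteSpin_eq_torusLeftEmbed n hx 2
  have e2 : (siteSpin n (Torus.reflectBetweenSites j a x) 2 : Op (TorusSite d L) (n + 1)) =
      torusRightEmbed L j a hL (siteSpin n (torusToLeft L j a hL x) 2) := by
    rw [siteSpin_eq_torusRightEmbed n hθ, torusToLeft_reflectBetweenSites]
  unfold torusZZCrossOp
  set X : Op (torusLeftHalf L j a) (n + 1) := siteSpin n (torusToLeft L j a hL x) 2 with hX
  have hP : torusLeftEmbed L j a hL X * torusRightEmbed L j a hL X =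
      torusRightEmbed L j a hL X * torusLeftEmbed L j a hL X := by
    rw [torusLeftEmbed_mul_torusRightEmbed, torusRightEmbed_mul_torusLeftEmbed]
  rw [spinBond, e1, e2, ← hP, ← two_smul ℂ, smul_smul]
  norm_num

variable (L j a hL n)

/-- **The Kronecker form of the `S³S³` bond sum**: along the planes,
`Σ_{⟨xy⟩} S³S³ = Z ⊗ 1 + 1 ⊗ Z + Σ_{x crossing} T³_x ⊗ T³_x` (left bonds, right bonds — read
through the reflection, which is a graph automorphism — and crossing bonds `{x, θx}`).
[cite: DLS1978, Lemma 6.1, Thm. 6.1] -/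
theorem torusZZBondSum_eq_submatrix :
    torusZZBondSum (d := d) L n =
      torusLeftEmbed L j a hL (torusZZLeft L j a hL n) +
        torusRightEmbed L j a hL (torusZZLeft L j a hL n) +
        ∑ x : torusCrossSites L j a,
          torusLeftEmbed L j a hL (torusZZCrossOp L j a hL n x) *
            torusRightEmbed L j a hL (torusZZCrossOp L j a hL n x) := by
  rw [torusZZBondSum, sum_edgeFinset_split L j a hL]
  set T : Sym2 (TorusSite d L) → Op (torusLeftHalf L j a) (n + 1) := fun e =>
    Sym2.lift ⟨fun x y => spinBond n 2 (torusToLeft L j a hL x) (torusToLeft L j a hL y),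
      fun _ _ => spinBond_two_symm n _ _⟩ e with hT
  -- (1) left bonds
  have h1 : ∑ e ∈ torusLeftEdges L j a,
      Sym2.lift ⟨fun x y => spinBond n 2 x y, spinBond_two_symm n⟩ e =
        torusLeftEmbed L j a hL (∑ e ∈ torusLeftEdges L j a, T e) := by
    rw [map_sum]
    refine sum_congr rfl fun e he => ?_
    obtain ⟨-, hl⟩ := mem_filter.1 he
    revert hl
    refine Sym2.ind (fun x y => ?_) e
    intro hl
    simp only [hT, Sym2.lift_mk]
    exact spinBond_two_eq_torusLeftEmbed (hl x (Sym2.mem_mk_left x y))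
      (hl y (Sym2.mem_mk_right x y))
  -- (2) right bonds
  have h2 : ∑ e ∈ ((torusGraph d L).edgeFinset.filter fun e => ∀ x ∈ e, x ∉ torusLeftHalf L j a),
      Sym2.lift ⟨fun x y => spinBond n 2 x y, spinBond_two_symm n⟩ e =
        torusRightEmbed L j a hL (∑ e ∈ torusLeftEdges L j a, T e) := by
    rw [← sum_rightEdges_eq_sum_leftEdges L j a hL T, map_sum]
    · refine sum_congr rfl fun e he => ?_
      obtain ⟨-, hr⟩ := mem_filter.1 he
      revert hr
      refine Sym2.ind (fun x y => ?_) e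
      intro hr
      simp only [hT, Sym2.lift_mk]
      exact spinBond_two_eq_torusRightEmbed (hr x (Sym2.mem_mk_left x y))
        (hr y (Sym2.mem_mk_right x y))
    · intro e
      refine Sym2.ind (fun x y => ?_) e
      simp only [hT, Sym2.map_mk, Sym2.lift_mk, torusToLeft_reflectBetweenSites]
  -- (3) crossing bonds
  have h3 : ∑ x ∈ torusCrossSites L j a,
      Sym2.lift ⟨fun x y => spinBond n 2 x y, spinBond_two_symm n⟩
        s(x, Torus.reflectBetweenSites j a x) =
      ∑ x : torusCrossSites L j a,
          torusLeftEmbed L j a hL (torusZZCrossOp L j a hL n x) *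
            torusRightEmbed L j a hL (torusZZCrossOp L j a hL n x) := by
    rw [← Finset.sum_coe_sort (torusCrossSites L j a)]
    refine sum_congr rfl fun x _ => ?_
    rw [Sym2.lift_mk]
    exact spinBond_two_cross x
  rw [h1, h2, h3, torusZZLeft]

/-- **The Kronecker form of the rotated antiferromagnetic field Hamiltonian** ([DLS1978]
Thm. 6.1 with Lemma 6.1; [KLS1988JSP] eq. (21) with the third component added): along the
planes, `X(g) = (A - Z) ⊗ 1 + 1 ⊗ (B - Z) - (Σᵢ Mᵢ ⊗ Nᵢ + Σ_x T³_x ⊗ T³_x)` with the XY data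
`A = H^L(g)`, `B = H^L(g ∘ θ)`, `Mᵢ = Mᵢ(g)`, `Nᵢ = Mᵢ(g ∘ θ)`. [cite: DLS1978, Thm. 6.1] -/
theorem dlsField_eq_submatrix (g : TorusSite d L → ℝ) :
    dlsField L n g =
      ((xyLeftHamiltonian L j a hL n g - torusZZLeft L j a hL n) ⊗ₖ
            (1 : Op (torusLeftHalf L j a) (n + 1)) +
          (1 : Op (torusLeftHalf L j a) (n + 1)) ⊗ₖ
            (xyLeftHamiltonian L j a hL n (fun y => g (Torus.reflectBetweenSites j a y)) -
              torusZZLeft L j a hL n) -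
          ∑ i : torusCrossSites L j a × Bool ⊕ torusCrossSites L j a,
            (Sum.elim (xyCrossOp L j a hL n g) (torusZZCrossOp L j a hL n) i) ⊗ₖ
              (Sum.elim (xyCrossOp L j a hL n (fun y => g (Torus.reflectBetweenSites j a y)))
                (torusZZCrossOp L j a hL n) i)).submatrix
        (torusSplit L j a hL) (torusSplit L j a hL) := by
  rw [submatrix_kroneckerForm, dlsField, xyRealFieldHamiltonian_eq_submatrix L j a hL n g,
    submatrix_kroneckerForm, torusZZBondSum_eq_submatrix L j a hL n, Fintype.sum_sum_type]
  simp only [Sum.elim_inl, Sum.elim_inr, map_sub]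
  abel

/-- `Z` is Hermitian. [folklore] -/
theorem torusZZLeft_isHermitian : (torusZZLeft L j a hL n).IsHermitian := by
  rw [torusZZLeft, IsHermitian, conjTranspose_sum]
  refine sum_congr rfl fun e _ => ?_
  induction e using Sym2.ind with
  | h x y =>
    simp only [Sym2.lift_mk]
    exact (spinBond_isHermitian n 2 _ _).eq

/-- `Z` is a real matrix. [folklore] -/
theorem torusZZLeft_transpose_eq : (torusZZLeft L j a hL n)ᵀ = (torusZZLeft L j a hL n)ᴴ := by
  rw [torusZZLeft, transpose_sum, conjTranspose_sum]
  refine sum_congr rfl fun e _ => ?_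
  induction e using Sym2.ind with
  | h x y =>
    simp only [Sym2.lift_mk]
    exact spinBond_two_transpose_eq n _ _

/-- `T³_x` is a real matrix. [folklore] -/
theorem torusZZCrossOp_transpose_eq (x : torusCrossSites L j a) :
    (torusZZCrossOp L j a hL n x)ᵀ = (torusZZCrossOp L j a hL n x)ᴴ :=
  siteSpin_two_transpose_eq n _

/-- All crossing operators of the rotated antiferromagnet are real. [cite: DLS1978, Lemma 6.1] -/
theorem dlsCrossOp_transpose_eq (g : TorusSite d L → ℝ)
    (i : torusCrossSites L j a × Bool ⊕ torusCrossSites L j a) :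
    (Sum.elim (xyCrossOp L j a hL n g) (torusZZCrossOp L j a hL n) i)ᵀ =
      (Sum.elim (xyCrossOp L j a hL n g) (torusZZCrossOp L j a hL n) i)ᴴ := by
  rcases i with i | x
  · exact xyCrossOp_transpose_eq L j a n hL g i
  · exact torusZZCrossOp_transpose_eq L j a hL n x

/-- The half-space operator `A - Z` is real. [cite: DLS1978, Lemma 6.1] -/
theorem dlsLeft_transpose_eq (g : TorusSite d L → ℝ) :
    (xyLeftHamiltonian L j a hL n g - torusZZLeft L j a hL n)ᵀ =
      (xyLeftHamiltonian L j a hL n g - torusZZLeft L j a hL n)ᴴ :=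
  transpose_eq_conjTranspose_sub (xyLeftHamiltonian_transpose_eq L j a n hL g)
    (torusZZLeft_transpose_eq L j a hL n)

end KroneckerForm


/-! ### The field enters only through `-t V + ½ t² Q` -/

section FieldExpansion

variable (L : ℕ) [NeZero L] (n : ℕ)

/-- `H♭(h) = H♭(0) + (H(h) - H_XY)`: the rotated field Hamiltonian differs from the rotated XY
Hamiltonian by the same field terms as the unrotated one (side `L ≥ 3`, where bonds are the
pairs `(x, x + eᵢ)`). [cite: KLS1988JSP, eqs. (16)–(17)] -/
theorem xyRealFieldHamiltonian_eq_add (hL3 : 3 ≤ L) (h : TorusSite d L → ℝ) :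
    xyRealFieldHamiltonian L n h =
      xyRealFieldHamiltonian L n 0 + (xyFieldHamiltonian L n h - xyTorus d L n) := by
  rw [xyFieldHamiltonian_eq_edgeSum L hL3 n h, xyTorus_eq_bondSum (d := d) L n,
    xyRealFieldHamiltonian, xyRealFieldHamiltonian, ← sum_sub_distrib, ← sum_add_distrib]
  refine sum_congr rfl fun e _ => ?_
  induction e using Sym2.ind with
  | h x y =>
    simp only [Sym2.lift_mk, xyRealBond, Pi.zero_apply, sub_zero, Complex.ofReal_zero, zero_smul,
      Complex.ofReal_neg, Complex.ofReal_one, neg_smul, one_smul]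
    norm_num
    abel

/-- **The field as a perturbation**: `X(t g) = X(0) - t V_g + ½ t² Q(g)` with
`V_g = Σ_{x,i}(g_x - g_{x+eᵢ})(S¹_x - S¹_{x+eᵢ})` (`xyGradField`) and `Q(g) = Σ_{x,i}(g_x - g_{x+eᵢ})²`
(`xyFieldEnergy`), side `L ≥ 3` — the form `H - tV + ½t²Q` consumed by
`Matrix.gaussianDomination_duhamel_le`. [cite: DLS1978, Thm. 4.2 (eq. (43)) and eq. (44)] -/
theorem dlsField_smul (hL3 : 3 ≤ L) (t : ℝ) (g : TorusSite d L → ℝ) :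
    dlsField L n (t • g) =
      dlsField L n 0 - (t : ℂ) • xyGradField L n g +
        ((t ^ 2 * xyFieldEnergy L g / 2 : ℝ) : ℂ) • (1 : Op (TorusSite d L) (n + 1)) := by
  rw [dlsField, dlsField, xyRealFieldHamiltonian_eq_add L n hL3 (t • g), xyFieldHamiltonian_smul,
    smul_neg]
  abel

/-- A bond with equal field values carries no field term. [folklore] -/
theorem xyRealBond_eq_of_eq {Λ : Type*} [Fintype Λ] [DecidableEq Λ] {g : Λ → ℝ} {x y : Λ}
    (hxy : g x = g y) : xyRealBond n g x y = xyRealBond n 0 x y := by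
  simp [xyRealBond, hxy]

/-- A field that is constant on every bond gives the unperturbed operator: `X(g) = X(0)`.
[cite: DLS1978, proof of Thm. 4.2 ("so it must be that all h's are zero")] -/
theorem dlsField_eq_of_badBondCount_eq_zero {g : TorusSite d L → ℝ}
    (h0 : badBondCount L g = 0) : dlsField L n g = dlsField L n 0 := by
  classical
  rw [badBondCount, Finset.card_eq_zero, Finset.filter_eq_empty_iff] at h0
  rw [dlsField, dlsField, xyRealFieldHamiltonian, xyRealFieldHamiltonian]
  congr 1
  refine sum_congr rfl fun e he => ?_
  have h1 := h0 he
  induction e using Sym2.ind with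
  | h x y =>
    rw [not_not, Sym2.map_mk, Sym2.mk_isDiag_iff] at h1
    simp only [Sym2.lift_mk]
    exact xyRealBond_eq_of_eq n h1

end FieldExpansion

/-! ### The reflection inequality `Z(g)² ≤ Z(g^L) Z(g^R)` -/

section Reflection

variable (L : ℕ) [NeZero L] (j : Fin d) (a : ZMod L) (n : ℕ)

/-- **The reflection inequality for the partition function** ([DLS1978] Lemma 6.1 applied as
in the proofs of Thms. 4.2 and 6.1): on the even torus of side `L ≥ 3`, for every pair of
planes, every `β > 0` and every real field `g` on `S¹`, `Z(g)² ≤ Z(g^L) Z(g^R)` for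
`Z(f) = Tr exp(-β X(f))`. The three operators are the Kronecker forms
`(A-Z)⊗1 + 1⊗(B-Z) - ΣMᵢ⊗Nᵢ`, `(A-Z)⊗1 + 1⊗(A-Z) - ΣMᵢ⊗Mᵢ`, `(B-Z)⊗1 + 1⊗(B-Z) - ΣNᵢ⊗Nᵢ` with
real `A, B, Z, Mᵢ, Nᵢ`, and `Matrix.trace_exp_kroneckerSum_le` applies.
[cite: DLS1978, Lemma 4.1, Lemma 6.1, Thm. 6.1] -/
theorem partitionFn_dlsField_sq_le (hL : Even L) {β : ℝ} (hβ : 0 < β)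
    (g : TorusSite d L → ℝ) :
    (partitionFn β (dlsField L n g)).re ^ 2 ≤
      (partitionFn β (dlsField L n (reflectFieldLeft L j a g))).re *
        (partitionFn β (dlsField L n (reflectFieldRight L j a g))).re := by
  -- positivity of the three partition functions
  have hZpos : ∀ f : TorusSite d L → ℝ, 0 < (partitionFn β (dlsField L n f)).re :=
    fun f => (partitionFn_re_pos β (dlsField_isHermitian L n f)).1
  have hx0 := hZpos g
  have hy0 := hZpos (reflectFieldLeft L j a g)
  have hz0 := hZpos (reflectFieldRight L j a g)
  -- abbreviations
  set A := xyLeftHamiltonian L j a hL n g - torusZZLeft L j a hL n with hA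
  set B := xyLeftHamiltonian L j a hL n (fun y => g (Torus.reflectBetweenSites j a y)) -
    torusZZLeft L j a hL n with hB
  set M : torusCrossSites L j a × Bool ⊕ torusCrossSites L j a → Op (torusLeftHalf L j a) (n + 1) :=
    Sum.elim (xyCrossOp L j a hL n g) (torusZZCrossOp L j a hL n) with hM
  set N : torusCrossSites L j a × Bool ⊕ torusCrossSites L j a → Op (torusLeftHalf L j a) (n + 1) :=
    Sum.elim (xyCrossOp L j a hL n (fun y => g (Torus.reflectBetweenSites j a y)))
      (torusZZCrossOp L j a hL n) with hN
  set e := torusSplit (q := n + 1) L j a hL with he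
  -- the three Kronecker forms
  have hK : dlsField L n g = (A ⊗ₖ 1 + 1 ⊗ₖ B - ∑ i, M i ⊗ₖ N i).submatrix e e :=
    dlsField_eq_submatrix L j a hL n g
  have hKL : dlsField L n (reflectFieldLeft L j a g) =
      (A ⊗ₖ 1 + 1 ⊗ₖ A - ∑ i, M i ⊗ₖ M i).submatrix e e := by
    rw [dlsField_eq_submatrix L j a hL n,
      xyLeftHamiltonian_congr L j a n hL (fun x hx => reflectFieldLeft_of_mem L j a g hx),
      xyLeftHamiltonian_congr L j a n hL
        (fun x hx => reflectFieldLeft_reflectBetweenSites_of_mem L j a hL g hx),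
      xyCrossOp_congr L j a n hL (fun x hx => reflectFieldLeft_of_mem L j a g hx),
      xyCrossOp_congr L j a n hL
        (fun x hx => reflectFieldLeft_reflectBetweenSites_of_mem L j a hL g hx)]
  have hKR : dlsField L n (reflectFieldRight L j a g) =
      (B ⊗ₖ 1 + 1 ⊗ₖ B - ∑ i, N i ⊗ₖ N i).submatrix e e := by
    rw [dlsField_eq_submatrix L j a hL n,
      xyLeftHamiltonian_congr L j a n hL (fun x hx => reflectFieldRight_of_mem L j a g hx),
      xyLeftHamiltonian_congr L j a n hL
        (h₁ := fun y => reflectFieldRight L j a g (Torus.reflectBetweenSites j a y))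
        (fun x hx => reflectFieldRight_reflectBetweenSites_of_mem L j a hL g hx),
      xyCrossOp_congr L j a n hL (fun x hx => reflectFieldRight_of_mem L j a g hx),
      xyCrossOp_congr L j a n hL
        (h₁ := fun y => reflectFieldRight L j a g (Torus.reflectBetweenSites j a y))
        (fun x hx => reflectFieldRight_reflectBetweenSites_of_mem L j a hL g hx)]
  -- partition functions as traces of exponentials of the DLS forms
  have hZ : ∀ (X Y : Op (torusLeftHalf L j a) (n + 1))
      (P Q : torusCrossSites L j a × Bool ⊕ torusCrossSites L j a → Op (torusLeftHalf L j a) (n + 1)),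
      partitionFn β ((X ⊗ₖ (1 : Op (torusLeftHalf L j a) (n + 1)) +
        (1 : Op (torusLeftHalf L j a) (n + 1)) ⊗ₖ Y - ∑ i, P i ⊗ₖ Q i).submatrix e e) =
      (exp ((-(β : ℂ) • X) ⊗ₖ (1 : Op (torusLeftHalf L j a) (n + 1)) +
        (1 : Op (torusLeftHalf L j a) (n + 1)) ⊗ₖ (-(β : ℂ) • Y) +
        ∑ i, ((Real.sqrt β : ℂ) • P i) ⊗ₖ ((Real.sqrt β : ℂ) • Q i))).trace := by
    intro X Y P Q
    rw [partitionFn_submatrix_equiv, partitionFn, gibbsWeight,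
      Literature.Barriers.AtomisticToContinuum.BoseGas.neg_smul_kroneckerForm hβ.le]
  -- reality
  have hnegβ : ∀ {X : Op (torusLeftHalf L j a) (n + 1)}, Xᵀ = Xᴴ →
      (-(β : ℂ) • X)ᵀ = (-(β : ℂ) • X)ᴴ := by
    intro X hX
    have h := transpose_eq_conjTranspose_ofReal_smul hX (-β)
    rwa [Complex.ofReal_neg] at h
  have hAt : (-(β : ℂ) • A)ᵀ = (-(β : ℂ) • A)ᴴ := hnegβ (dlsLeft_transpose_eq L j a hL n g)
  have hBt : (-(β : ℂ) • B)ᵀ = (-(β : ℂ) • B)ᴴ := hnegβ (dlsLeft_transpose_eq L j a hL n _)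
  have hMt : ∀ i, ((Real.sqrt β : ℂ) • M i)ᵀ = ((Real.sqrt β : ℂ) • M i)ᴴ := fun i =>
    transpose_eq_conjTranspose_ofReal_smul (dlsCrossOp_transpose_eq L j a hL n g i) _
  have hNt : ∀ i, ((Real.sqrt β : ℂ) • N i)ᵀ = ((Real.sqrt β : ℂ) • N i)ᴴ := fun i =>
    transpose_eq_conjTranspose_ofReal_smul (dlsCrossOp_transpose_eq L j a hL n _ i) _
  haveI : Nonempty (torusLeftHalf L j a → Fin (n + 1)) := ⟨fun _ => 0⟩
  have hDLS := Matrix.trace_exp_kroneckerSum_le (m := torusLeftHalf L j a → Fin (n + 1))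
    (n := torusLeftHalf L j a → Fin (n + 1)) hAt hBt hMt hNt
  -- the inequality `Z(g) ≤ Z(g^L)^{1/2} Z(g^R)^{1/2}`
  have hineq : (partitionFn β (dlsField L n g)).re ≤
      Real.sqrt (partitionFn β (dlsField L n (reflectFieldLeft L j a g))).re *
        Real.sqrt (partitionFn β (dlsField L n (reflectFieldRight L j a g))).re := by
    rw [hK, hKL, hKR, hZ, hZ, hZ]
    exact hDLS
  calc _ ≤ (Real.sqrt (partitionFn β (dlsField L n (reflectFieldLeft L j a g))).re *
        Real.sqrt (partitionFn β (dlsField L n (reflectFieldRight L j a g))).re) ^ 2 :=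
        pow_le_pow_left₀ hx0.le hineq 2
    _ = _ := by rw [mul_pow, Real.sq_sqrt hy0.le, Real.sq_sqrt hz0.le]

end Reflection

/-! ### The descent: Gaussian domination -/

section Descent

variable (L : ℕ) [NeZero L] (n : ℕ)

/-- **Gaussian domination at positive temperature for the rotated Heisenberg antiferromagnet**
([DLS1978] Thm. 4.2, eq. (48): `Z({h}) ≤ Z({0})`, in the setting of Thm. 6.1): on the even torus
of side `L ≥ 4`, for every `β > 0`, every spin `n/2` and every real field `g` on the first
component, `Z_β(X(g)) ≤ Z_β(X(0))`, `X(g) = H♭(g) - ΣS³S³`. Proof: the descent of [DLS1978]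
pp. 355–356 — among the finitely many fields with values in the range of `g` take a maximiser
of `Z` with the fewest bonds `{x, y}` with `f_x ≠ f_y`; a bad bond and the planes through it
give `Z(f)² ≤ Z(f^L)Z(f^R)` (`partitionFn_dlsField_sq_le`), so `f^L`, `f^R` are maximisers and
one of them has fewer bad bonds (`badBondCount_reflect`) — contradiction; hence the maximiser
is constant on bonds and its operator is `X(0)` (`dlsField_eq_of_badBondCount_eq_zero`).
[cite: DLS1978, Thm. 4.2 (eq. (48)), Thm. 6.1] -/
theorem dls_partitionFn_field_le (hL : Even L) (h4 : 4 ≤ L) {β : ℝ} (hβ : 0 < β)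
    (g : TorusSite d L → ℝ) :
    (partitionFn β (dlsField L n g)).re ≤
      (partitionFn β (dlsField L n (0 : TorusSite d L → ℝ))).re := by
  classical
  have hL2 : 2 ≤ L := by omega
  -- the finite search space
  set V : Finset ℝ := (univ : Finset (TorusSite d L)).image g with hV
  set Zf : (TorusSite d L → V) → ℝ := fun f =>
    (partitionFn β (dlsField L n (fun x => (f x : ℝ)))).re with hZf
  set Nf : (TorusSite d L → V) → ℕ := fun f => badBondCount L (fun x => (f x : ℝ)) with hNf
  set g' : TorusSite d L → V := fun x => ⟨g x, mem_image_of_mem g (mem_univ x)⟩ with hg'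
  haveI : Nonempty (TorusSite d L → V) := ⟨g'⟩
  obtain ⟨f₀, hf₀⟩ := Finite.exists_max Zf
  set S : Finset (TorusSite d L → V) := univ.filter fun f => Zf f = Zf f₀ with hS
  obtain ⟨f₁, hf₁S, hf₁min⟩ := S.exists_min_image Nf ⟨f₀, by simp [hS]⟩
  have hZf₁ : Zf f₁ = Zf f₀ := (mem_filter.1 hf₁S).2
  -- positivity of `Z`
  have hZpos : ∀ f : TorusSite d L → ℝ, 0 < (partitionFn β (dlsField L n f)).re :=
    fun f => (partitionFn_re_pos β (dlsField_isHermitian L n f)).1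
  -- the maximiser has no bad bonds
  have hN0 : Nf f₁ = 0 := by
    by_contra hN
    -- a bad pair `(x₀, i)`
    obtain ⟨x₀, i, hbad⟩ : ∃ (x₀ : TorusSite d L) (i : Fin d),
        (f₁ x₀ : ℝ) ≠ f₁ (x₀ + Pi.single i 1) := by
      obtain ⟨e, he⟩ := Finset.card_ne_zero.1 hN
      obtain ⟨heE, hbe⟩ := mem_filter.1 he
      revert heE hbe
      refine Sym2.ind (fun u v => ?_) e
      intro heE hbe
      rw [SimpleGraph.mem_edgeFinset, SimpleGraph.mem_edgeSet, torusGraph_adj_iff] at heE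
      rw [Sym2.map_mk, Sym2.mk_isDiag_iff] at hbe
      obtain ⟨-, ⟨i, rfl⟩ | ⟨i, rfl⟩⟩ := heE
      · exact ⟨u, i, hbe⟩
      · exact ⟨v, i, fun h' => hbe h'.symm⟩
    -- the planes through it
    set j := i
    obtain ⟨hxCS, hθx⟩ := add_single_mem_torusCrossSites L hL2 j x₀
    set a : ZMod L := x₀ j with ha
    -- the reflected fields, inside the search space
    set φ : TorusSite d L → ℝ := fun x => (f₁ x : ℝ) with hφ
    set fL : TorusSite d L → V := fun y =>
      if y ∈ torusLeftHalf L j a then f₁ y else f₁ (Torus.reflectBetweenSites j a y) with hfL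
    set fR : TorusSite d L → V := fun y =>
      if y ∈ torusLeftHalf L j a then f₁ (Torus.reflectBetweenSites j a y) else f₁ y with hfR
    have hfLφ : (fun x => (fL x : ℝ)) = reflectFieldLeft L j a φ := by
      funext y
      simp only [hfL, reflectFieldLeft, hφ]
      split_ifs <;> rfl
    have hfRφ : (fun x => (fR x : ℝ)) = reflectFieldRight L j a φ := by
      funext y
      simp only [hfR, reflectFieldRight, hφ]
      split_ifs <;> rfl
    -- `Z(f₁)² ≤ Z(f^L) Z(f^R)`, and all three are at most the maximum `Z(f₁)`
    have hRP := partitionFn_dlsField_sq_le L j a n hL hβ φ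
    have hEL : Zf fL = (partitionFn β (dlsField L n (reflectFieldLeft L j a φ))).re := by
      simp only [hZf, hfLφ]
    have hER : Zf fR = (partitionFn β (dlsField L n (reflectFieldRight L j a φ))).re := by
      simp only [hZf, hfRφ]
    have hE1 : Zf f₁ = (partitionFn β (dlsField L n φ)).re := by simp only [hZf, hφ]
    rw [← hEL, ← hER, ← hE1] at hRP
    have h1 := hf₀ fL
    have h2 := hf₀ fR
    have hL0 : 0 < Zf fL := by rw [hEL]; exact hZpos _
    have hR0 : 0 < Zf fR := by rw [hER]; exact hZpos _
    -- both reflected fields are maximisers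
    have hELm : Zf fL = Zf f₀ := by
      by_contra hne
      have hlt : Zf fL < Zf f₀ := lt_of_le_of_ne h1 hne
      have : Zf fL * Zf fR < Zf f₀ * Zf f₀ := mul_lt_mul hlt h2 hR0 (hlt.le.trans' hL0.le)
      rw [hZf₁] at hRP
      nlinarith
    have hERm : Zf fR = Zf f₀ := by
      by_contra hne
      have hlt : Zf fR < Zf f₀ := lt_of_le_of_ne h2 hne
      have : Zf fL * Zf fR < Zf f₀ * Zf f₀ := mul_lt_mul' h1 hlt hR0.le (hL0.trans_le h1)
      rw [hZf₁] at hRP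
      nlinarith
    have hNL : Nf f₁ ≤ Nf fL := hf₁min fL (by simp [hS, hELm])
    have hNR : Nf f₁ ≤ Nf fR := hf₁min fR (by simp [hS, hERm])
    -- counting: `N(f^L) + N(f^R) + 2N_C = 2N(f)` with `N_C ≥ 1`
    have hcount := badBondCount_reflect L j a hL φ
    have hNLφ : Nf fL = badBondCount L (reflectFieldLeft L j a φ) := by simp only [hNf, hfLφ]
    have hNRφ : Nf fR = badBondCount L (reflectFieldRight L j a φ) := by simp only [hNf, hfRφ]
    have hN1φ : Nf f₁ = badBondCount L φ := by simp only [hNf, hφ]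
    have hC : 1 ≤ ∑ x ∈ torusCrossSites L j a,
        (if (Sym2.map φ s(x, Torus.reflectBetweenSites j a x)).IsDiag then 0 else 1) := by
      have hone : (if (Sym2.map φ s(x₀ + Pi.single j 1,
          Torus.reflectBetweenSites j a (x₀ + Pi.single j 1))).IsDiag then 0 else 1) = 1 := by
        simp only [hθx, Sym2.map_mk, Sym2.mk_isDiag_iff]
        rw [if_neg]
        exact fun h' => hbad h'.symm
      calc 1 = (if (Sym2.map φ s(x₀ + Pi.single j 1,
          Torus.reflectBetweenSites j a (x₀ + Pi.single j 1))).IsDiag then 0 else 1) := hone.symm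
        _ ≤ _ := Finset.single_le_sum (f := fun x =>
          if (Sym2.map φ s(x, Torus.reflectBetweenSites j a x)).IsDiag then 0 else 1)
          (fun _ _ => Nat.zero_le _) hxCS
    rw [← hNLφ, ← hNRφ, ← hN1φ] at hcount
    omega
  -- hence `X(f₁) = X(0)` and `Z(g) ≤ Z(f₁) = Z(X(0))`
  have hH : dlsField L n (fun x => (f₁ x : ℝ)) = dlsField L n 0 :=
    dlsField_eq_of_badBondCount_eq_zero L n hN0
  have hEg : Zf g' = (partitionFn β (dlsField L n g)).re := by simp only [hZf, hg']
  have h1 : Zf f₁ = (partitionFn β (dlsField L n (0 : TorusSite d L → ℝ))).re := by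
    simp only [hZf, hH]
  rw [← hEg, ← h1, hZf₁]
  exact hf₀ g'

end Descent

end Literature.MathematicalPhysics.QuantumLattice
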